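import Mathlib
import HarnessLib
import Literature.Analysis.FunctionSpaces.TorusPlateauCutoff
import Summits.QuantumFields.YangMills.Theorems.ComplexCouplingChannelContinuumLegGivenGapProductToUniformDefs

/-!
# `ContinuumLegGivenGap` (stmt-QuantumFields-15828), line `alternating-curvature-arrays`: `stub_ptuDerivatives`, helper 1 — geometric derivative bounds of the one-dimensional profile, the plateau and the one-point cut-off

Support file for the registered stub `stub_ptuDerivatives` (derivative bounds of the Whitney system of
`stub_productToUniform`).  Everything is expressed in the GEOMETRIC shape consumed by Mathlib's
`norm_iteratedFDeriv_comp_le` and the tree's all-orders Leibniz bound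
`Literature.Analysis.FunctionSpaces.norm_iteratedFDeriv_finset_prod_le_pow`: for a target order `N`,
`‖Dᵃ f‖ ≤ Kᵃ` for all `a ≤ N` (so `|f| ≤ 1` at `a = 0`), with `K` polynomial in `N`:

* §1 generic calculus: composition with a continuous linear map (`‖Dᵃ(f ∘ g)‖ ≤ ‖g‖ᵃ ‖Dᵃ f‖`), `1 - f` for
  `[0,1]`-valued `f`, and the inverse `1/f` at a point for `f ≥ 1` (Faà di Bruno bound
  `norm_iteratedFDeriv_comp_le'` with `|(1/t)⁽ⁱ⁾| = i!/tⁱ⁺¹ ≤ i!` on `t ≥ 1`);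
* §2 the Gevrey step `ptuStep` (`|θ⁽ᵃ⁾| ≤ 2¹⁴ 18ᵃ (a!)² ≤ (2¹⁹ (N+1)²)ᵃ` for `1 ≤ a ≤ N`, `a! ≤ (N+1)ᵃ`), its affine
  rescalings `t ↦ θ((t - lo)/w)`, `t ↦ θ((hi - t)/w)` (factor `w⁻ᵃ`), the plateau `ptuPlateau lo hi w` (two factors:
  `(2K/w)ᵃ`) and the one-point cut-off `ptuCut` (four coordinate factors: `(8K/(a w))ᵃ`, registered anchor
  `ptuDeriv_cut_bound`).

Mathlib + the landed Defs + the tree's product Leibniz bound only; no definitions. [folklore]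
-/

set_option autoImplicit false

noncomputable section

open scoped Classical

namespace Summit.QuantumFields.YangMills.Theorems.ContinuumLegGivenGap

open scoped BigOperators ContDiff
open Filter Topology Set
open Summit.QuantumFields.YangMills.Theorems.ContinuumLegGivenGap.AlternatingArrays
open Literature.Analysis.FunctionSpaces (norm_iteratedFDeriv_mul_le_add_pow norm_iteratedFDeriv_finset_prod_le_pow)

/-! ## §1 Generic calculus in geometric form -/

section Generic

variable {E F : Type*} [NormedAddCommGroup E] [NormedSpace ℝ E] [NormedAddCommGroup F] [NormedSpace ℝ F]

/-- Composition with a continuous linear map on the right: `‖Dᵃ(f ∘ g)(x)‖ ≤ ‖g‖ᵃ ‖Dᵃ f (g x)‖`. [folklore] -/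
theorem ptuDeriv_norm_iteratedFDeriv_comp_clm_le (g : E →L[ℝ] F) {f : F → ℝ} (hf : ContDiff ℝ ∞ f) (a : ℕ)
    (x : E) : ‖iteratedFDeriv ℝ a (f ∘ g) x‖ ≤ ‖g‖ ^ a * ‖iteratedFDeriv ℝ a f (g x)‖ := by
  rw [g.iteratedFDeriv_comp_right hf x (by exact_mod_cast le_top)]
  refine (ContinuousMultilinearMap.norm_compContinuousLinearMap_le _ _).trans (le_of_eq ?_)
  rw [Finset.prod_const, Finset.card_univ, Fintype.card_fin, mul_comm]

/-- Geometric bounds survive composition with a continuous linear map of norm `≤ M`, at the price `K ↦ M K`.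
[folklore] -/
theorem ptuDeriv_geom_comp_clm (g : E →L[ℝ] F) {M : ℝ} (hM : ‖g‖ ≤ M) {f : F → ℝ} (hf : ContDiff ℝ ∞ f)
    {K : ℝ} {N : ℕ} (h : ∀ a ≤ N, ∀ y, ‖iteratedFDeriv ℝ a f y‖ ≤ K ^ a) :
    ∀ a ≤ N, ∀ x, ‖iteratedFDeriv ℝ a (f ∘ g) x‖ ≤ (M * K) ^ a := by
  intro a ha x
  refine (ptuDeriv_norm_iteratedFDeriv_comp_clm_le g hf a x).trans ?_
  rw [mul_pow]
  exact mul_le_mul (pow_le_pow_left₀ (norm_nonneg _) hM a) (h a ha _) (norm_nonneg _)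
    (pow_nonneg ((norm_nonneg _).trans hM) a)

/-- `1 - f` for a `[0,1]`-valued `f`: same geometric bounds, values again in `[0,1]`. [folklore] -/
theorem ptuDeriv_geom_one_sub {f : E → ℝ} {N : ℕ} (hf : ContDiff ℝ N f) (h01 : ∀ x, 0 ≤ f x ∧ f x ≤ 1) {K : ℝ}
    (h : ∀ a ≤ N, ∀ x, ‖iteratedFDeriv ℝ a f x‖ ≤ K ^ a) :
    (∀ x, 0 ≤ 1 - f x ∧ 1 - f x ≤ 1) ∧ ∀ a ≤ N, ∀ x, ‖iteratedFDeriv ℝ a (fun y => 1 - f y) x‖ ≤ K ^ a := by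
  refine ⟨fun x => ⟨by linarith [(h01 x).2], by linarith [(h01 x).1]⟩, fun a ha x => ?_⟩
  rcases Nat.eq_zero_or_pos a with rfl | hpos
  · rw [norm_iteratedFDeriv_zero, pow_zero, Real.norm_eq_abs, abs_le]
    exact ⟨by linarith [(h01 x).2], by linarith [(h01 x).1]⟩
  · have hsub : (fun y => 1 - f y) = (fun _ => (1 : ℝ)) - f := rfl
    have hfa : ContDiffAt ℝ a f x := (hf.of_le (by exact_mod_cast ha)).contDiffAt
    rw [hsub, iteratedFDeriv_sub_apply contDiffAt_const hfa, iteratedFDeriv_const_of_ne hpos.ne', Pi.zero_apply,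
      zero_sub, norm_neg]
    exact h a ha x

/-- **The inverse at a point.** If `f ≥ 1` is smooth and `‖Dⁱ f (x)‖ ≤ Dⁱ` for `1 ≤ i ≤ N`, then
`‖Dᵏ (1/f)(x)‖ ≤ ((N+1)² D)ᵏ` for all `k ≤ N` (Faà di Bruno: `k! · k! · Dᵏ`, and `k! ≤ (N+1)ᵏ`). [folklore] -/
theorem ptuDeriv_geom_inv {f : E → ℝ} (hf : ContDiff ℝ ∞ f) (h1 : ∀ x, 1 ≤ f x) {N : ℕ} {D : ℝ} (hD0 : 0 ≤ D)
    (x : E) (hD : ∀ i, 1 ≤ i → i ≤ N → ‖iteratedFDeriv ℝ i f x‖ ≤ D ^ i) :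
    ∀ k ≤ N, ‖iteratedFDeriv ℝ k (fun y => (f y)⁻¹) x‖ ≤ (((N : ℝ) + 1) ^ 2 * D) ^ k := by
  intro k hk
  have hft : Set.range f ⊆ Set.Ioi (1 / 2) := by
    rintro _ ⟨z, rfl⟩
    exact lt_of_lt_of_le (by norm_num) (h1 z)
  have hg : ContDiffOn ℝ ∞ (Inv.inv : ℝ → ℝ) (Set.Ioi (1 / 2)) :=
    (contDiffOn_inv ℝ).mono fun t ht => by
      simp only [mem_compl_iff, mem_singleton_iff]
      exact (lt_trans (by norm_num) (mem_Ioi.1 ht)).ne'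
  have hcomp : (fun y => (f y)⁻¹) = Inv.inv ∘ f := rfl
  rw [hcomp]
  have hC : ∀ i, i ≤ k → ‖iteratedFDerivWithin ℝ i (Inv.inv : ℝ → ℝ) (Set.Ioi (1 / 2)) (f x)‖ ≤ k.factorial := by
    intro i hi
    rw [norm_iteratedFDerivWithin_eq_norm_iteratedDerivWithin,
      iteratedDerivWithin_of_isOpen_eq_iterate isOpen_Ioi (hft ⟨x, rfl⟩), iter_deriv_inv, norm_mul, norm_mul,
      norm_pow, norm_neg, norm_one, one_pow, one_mul, Real.norm_natCast]
    have hfx : 1 ≤ f x := h1 x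
    have hz : ‖f x ^ (-1 - (i : ℤ))‖ ≤ 1 := by
      rw [show (-1 - (i : ℤ)) = -((i + 1 : ℕ) : ℤ) by push_cast; ring, zpow_neg, zpow_natCast, norm_inv, norm_pow,
        Real.norm_eq_abs, abs_of_pos (by linarith)]
      exact inv_le_one_of_one_le₀ (one_le_pow₀ hfx)
    calc (i.factorial : ℝ) * ‖f x ^ (-1 - (i : ℤ))‖ ≤ i.factorial * 1 := by gcongr
      _ ≤ k.factorial := by rw [mul_one]; exact_mod_cast Nat.factorial_le hi
  have h := norm_iteratedFDeriv_comp_le' hft (uniqueDiffOn_Ioi _) hg hf (mod_cast le_top) x hC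
    (fun i h1i hik => hD i h1i (hik.trans hk))
  refine h.trans ?_
  have hfac : (k.factorial : ℝ) ≤ ((N : ℝ) + 1) ^ k := by
    have h' := (Nat.factorial_le_pow k).trans (Nat.pow_le_pow_left (Nat.le_succ_of_le hk) k)
    exact_mod_cast h'
  have h0 : (0 : ℝ) ≤ k.factorial := Nat.cast_nonneg _
  calc (k.factorial : ℝ) * k.factorial * D ^ k ≤ ((N : ℝ) + 1) ^ k * ((N : ℝ) + 1) ^ k * D ^ k := by gcongr
    _ = (((N : ℝ) + 1) ^ 2 * D) ^ k := by rw [mul_pow, sq, mul_pow]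

/-- A product of `[0,1]`-valued factors is `[0,1]`-valued. [folklore] -/
theorem ptuDeriv_prod_mem {ι X : Type*} (s : Finset ι) {f : ι → X → ℝ} (h : ∀ i ∈ s, ∀ x, 0 ≤ f i x ∧ f i x ≤ 1)
    (x : X) : 0 ≤ ∏ i ∈ s, f i x ∧ ∏ i ∈ s, f i x ≤ 1 :=
  ⟨Finset.prod_nonneg fun i hi => (h i hi x).1, Finset.prod_le_one (fun i hi => (h i hi x).1) fun i hi => (h i hi x).2⟩

/-- Norm form of `[0,1]`-valuedness. [folklore] -/
theorem ptuDeriv_norm_le_one_of_mem {X : Type*} {f : X → ℝ} (h : ∀ x, 0 ≤ f x ∧ f x ≤ 1) (x : X) : ‖f x‖ ≤ 1 := by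
  rw [Real.norm_eq_abs, abs_le]
  exact ⟨by linarith [(h x).1], (h x).2⟩

/-- **All-orders Leibniz for many `[0,1]`-valued factors** in the geometric shape used here (the tree's
`norm_iteratedFDeriv_finset_prod_le_pow`): `‖Dᵃ ∏_{i∈s} fᵢ‖ ≤ (#s · K)ᵃ`. [folklore] -/
theorem ptuDeriv_geom_prod {ι : Type*} (s : Finset ι) {f : ι → E → ℝ} {N : ℕ} (hf : ∀ i ∈ s, ContDiff ℝ N (f i))
    {K : ℝ} (hK : 0 ≤ K) (h : ∀ i ∈ s, ∀ a ≤ N, ∀ x, ‖iteratedFDeriv ℝ a (f i) x‖ ≤ K ^ a) :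
    ∀ a ≤ N, ∀ x, ‖iteratedFDeriv ℝ a (fun y => ∏ i ∈ s, f i y) x‖ ≤ ((s.card : ℝ) * K) ^ a := by
  intro a ha x
  have h1 : ∀ i ∈ s, ∀ x, ‖f i x‖ ≤ 1 := fun i hi x => by
    have := h i hi 0 (Nat.zero_le _) x
    rwa [norm_iteratedFDeriv_zero, pow_zero] at this
  have hmain := norm_iteratedFDeriv_finset_prod_le_pow s (L := fun _ => K) hf h1 (fun _ _ => hK)
    (fun i hi b _ hb x => h i hi b hb x) a ha x
  rwa [Finset.sum_const, nsmul_eq_mul] at hmain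

end Generic

/-! ## §2 The profile, the plateau and the one-point cut-off -/

/-- **The Gevrey step in geometric form**: for `a ≤ N`, `‖Dᵃ θ‖ ≤ (2¹⁹ (N+1)²)ᵃ` (`|θ| ≤ 1`;
`2¹⁴ 18ᵃ (a!)² ≤ (2¹⁴ · 18 · (N+1)²)ᵃ` for `a ≥ 1`). [folklore] -/
theorem ptuDeriv_step_bound (N : ℕ) :
    ∀ a ≤ N, ∀ x, ‖iteratedFDeriv ℝ a ptuStep x‖ ≤ ((2 : ℝ) ^ 19 * ((N : ℝ) + 1) ^ 2) ^ a := by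
  intro a ha x
  rw [norm_iteratedFDeriv_eq_norm_iteratedDeriv, Real.norm_eq_abs]
  rcases Nat.eq_zero_or_pos a with rfl | hpos
  · rw [iteratedDeriv_zero, pow_zero, abs_le]
    have h := ptuStep_spec.2.2.2.1 x
    exact ⟨by linarith [h.1], h.2⟩
  · refine (ptuStep_spec.2.2.2.2.2 a x).trans ?_
    have hfac : (a.factorial : ℝ) ≤ ((N : ℝ) + 1) ^ a := by
      have h := (Nat.factorial_le_pow a).trans (Nat.pow_le_pow_left (Nat.le_succ_of_le ha) a)
      exact_mod_cast h
    have h0 : (0 : ℝ) ≤ a.factorial := Nat.cast_nonneg _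
    have hfac2 : (a.factorial : ℝ) ^ 2 ≤ (((N : ℝ) + 1) ^ 2) ^ a := by
      calc (a.factorial : ℝ) ^ 2 ≤ (((N : ℝ) + 1) ^ a) ^ 2 := by gcongr
        _ = (((N : ℝ) + 1) ^ 2) ^ a := by rw [← pow_mul, ← pow_mul, mul_comm]
    have h14 : (2 : ℝ) ^ 14 ≤ (2 ^ 14) ^ a := le_self_pow₀ (by norm_num) hpos.ne'
    calc (2 : ℝ) ^ 14 * 18 ^ a * (a.factorial : ℝ) ^ 2 ≤ (2 ^ 14) ^ a * 18 ^ a * (((N : ℝ) + 1) ^ 2) ^ a := by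
          gcongr
      _ = (2 ^ 14 * 18 * ((N : ℝ) + 1) ^ 2) ^ a := by rw [← mul_pow, ← mul_pow]
      _ ≤ (2 ^ 19 * ((N : ℝ) + 1) ^ 2) ^ a := by gcongr; norm_num

/-- The rising affine rescaling `t ↦ θ((t - lo)/w)`: `‖Dᵃ‖ ≤ (2¹⁹ (N+1)²/w)ᵃ` for `a ≤ N`. [folklore] -/
theorem ptuDeriv_step_up_bound {w : ℝ} (hw : 0 < w) (lo : ℝ) (N : ℕ) :
    ∀ a ≤ N, ∀ t, ‖iteratedFDeriv ℝ a (fun t => ptuStep ((t - lo) / w)) t‖ ≤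
      ((2 : ℝ) ^ 19 * ((N : ℝ) + 1) ^ 2 / w) ^ a := by
  intro a ha t
  have hθ : ContDiff ℝ a ptuStep := ptuStep_spec.1.of_le (mod_cast le_top)
  have hfun : (fun t => ptuStep ((t - lo) / w)) = fun t => (fun s => ptuStep (w⁻¹ * s)) (t - lo) := by
    funext t; simp only [div_eq_inv_mul]
  have h1 : iteratedDeriv a (fun t => ptuStep ((t - lo) / w)) t = (w⁻¹) ^ a * iteratedDeriv a ptuStep (w⁻¹ * (t - lo)) := by
    rw [hfun, iteratedDeriv_comp_sub_const a (fun s => ptuStep (w⁻¹ * s)) lo, iteratedDeriv_comp_const_mul hθ]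
  rw [norm_iteratedFDeriv_eq_norm_iteratedDeriv, h1, norm_mul, norm_pow, norm_inv, Real.norm_of_nonneg hw.le,
    ← norm_iteratedFDeriv_eq_norm_iteratedDeriv, div_eq_mul_inv, mul_pow, mul_comm]
  exact mul_le_mul_of_nonneg_right (ptuDeriv_step_bound N a ha _) (by positivity)

/-- The falling affine rescaling `t ↦ θ((hi - t)/w)`: `‖Dᵃ‖ ≤ (2¹⁹ (N+1)²/w)ᵃ` for `a ≤ N`. [folklore] -/
theorem ptuDeriv_step_down_bound {w : ℝ} (hw : 0 < w) (hi : ℝ) (N : ℕ) :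
    ∀ a ≤ N, ∀ t, ‖iteratedFDeriv ℝ a (fun t => ptuStep ((hi - t) / w)) t‖ ≤
      ((2 : ℝ) ^ 19 * ((N : ℝ) + 1) ^ 2 / w) ^ a := by
  intro a ha t
  have hθ : ContDiff ℝ a ptuStep := ptuStep_spec.1.of_le (mod_cast le_top)
  have hfun : (fun t => ptuStep ((hi - t) / w)) = fun t => (fun s => ptuStep (w⁻¹ * s)) (hi - t) := by
    funext t; simp only [div_eq_inv_mul]
  have h1 : iteratedDeriv a (fun t => ptuStep ((hi - t) / w)) t =
      (-1 : ℝ) ^ a • ((w⁻¹) ^ a * iteratedDeriv a ptuStep (w⁻¹ * (hi - t))) := by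
    rw [hfun, iteratedDeriv_comp_const_sub a (fun s => ptuStep (w⁻¹ * s)) hi, iteratedDeriv_comp_const_mul hθ]
  rw [norm_iteratedFDeriv_eq_norm_iteratedDeriv, h1, norm_smul, norm_pow, norm_neg, norm_one, one_pow, one_mul,
    norm_mul, norm_pow, norm_inv, Real.norm_of_nonneg hw.le, ← norm_iteratedFDeriv_eq_norm_iteratedDeriv,
    div_eq_mul_inv, mul_pow, mul_comm]
  exact mul_le_mul_of_nonneg_right (ptuDeriv_step_bound N a ha _) (by positivity)

/-- **The plateau**: `‖Dᵃ ptuPlateau lo hi w‖ ≤ (2²⁰ (N+1)²/w)ᵃ` for `a ≤ N` (`w > 0`; two factors). [folklore] -/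
theorem ptuDeriv_plateau_bound {w : ℝ} (hw : 0 < w) (lo hi : ℝ) (N : ℕ) :
    ∀ a ≤ N, ∀ t, ‖iteratedFDeriv ℝ a (ptuPlateau lo hi w) t‖ ≤ ((2 : ℝ) ^ 20 * ((N : ℝ) + 1) ^ 2 / w) ^ a := by
  intro a ha t
  have hθ : ContDiff ℝ N ptuStep := ptuStep_spec.1.of_le (mod_cast le_top)
  have hf : ContDiff ℝ N (fun t => ptuStep ((t - lo) / w)) := hθ.comp ((contDiff_id.sub contDiff_const).div_const w)
  have hg : ContDiff ℝ N (fun t => ptuStep ((hi - t) / w)) := hθ.comp ((contDiff_const.sub contDiff_id).div_const w)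
  have hK : (0 : ℝ) ≤ 2 ^ 19 * ((N : ℝ) + 1) ^ 2 / w := by positivity
  have h := norm_iteratedFDeriv_mul_le_add_pow hf hg hK t (ptuDeriv_step_up_bound hw lo N · · t)
    (ptuDeriv_step_down_bound hw hi N · · t) ha
  have heq : (2 : ℝ) ^ 19 * ((N : ℝ) + 1) ^ 2 / w + 2 ^ 19 * ((N : ℝ) + 1) ^ 2 / w = 2 ^ 20 * ((N : ℝ) + 1) ^ 2 / w := by
    ring
  rw [heq] at h
  exact h

/-- The coordinate projections of `ℝ⁴` (Euclidean norm) have operator norm `≤ 1`. [folklore] -/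
theorem ptuDeriv_norm_proj_le (μ : Fin 4) : ‖(EuclideanSpace.proj μ : EuclideanSpace ℝ (Fin 4) →L[ℝ] ℝ)‖ ≤ 1 :=
  ContinuousLinearMap.opNorm_le_bound _ zero_le_one fun u => by
    rw [one_mul]
    exact PiLp.norm_apply_le u μ

/-- **The one-point cut-off** (registered anchor): for `a w > 0` and every target order `N`,
`‖Dᵇ ptuCut a m v z e w (u)‖ ≤ (2²² (N+1)²/(a w))ᵇ` for all `b ≤ N` and all `u` (four plateau factors composed with
coordinate projections of norm `≤ 1`), and `ptuCut` takes values in `[0,1]`. [folklore] -/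
theorem ptuDeriv_cut_bound : ∀ (a w : ℝ), 0 < a * w → ∀ (m : ℕ) (v z : Fin 4 → ℤ) (e : ℝ) (N : ℕ),
    (∀ u, 0 ≤ ptuCut a m v z e w u ∧ ptuCut a m v z e w u ≤ 1) ∧
      ∀ b ≤ N, ∀ u, ‖iteratedFDeriv ℝ b (ptuCut a m v z e w) u‖ ≤ ((2 : ℝ) ^ 22 * ((N : ℝ) + 1) ^ 2 / (a * w)) ^ b := by
  intro a w haw m v z e N
  set P : Fin 4 → ℝ → ℝ := fun μ => ptuPlateau (a * ((v μ : ℝ) + cellSide m * (z μ : ℝ) + e))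
    (a * ((v μ : ℝ) + cellSide m * ((z μ : ℝ) + 1) - e)) (a * w) with hP
  set f : Fin 4 → EuclideanSpace ℝ (Fin 4) → ℝ := fun μ => P μ ∘ (EuclideanSpace.proj μ : EuclideanSpace ℝ (Fin 4) →L[ℝ] ℝ)
    with hf
  have hfun : ptuCut a m v z e w = fun u => ∏ μ ∈ (Finset.univ : Finset (Fin 4)), f μ u := by
    funext u; rfl
  have hPc : ∀ μ, ContDiff ℝ ∞ (P μ) := fun μ => ptuPlateau_contDiff _ _ _
  have hfc : ∀ μ ∈ (Finset.univ : Finset (Fin 4)), ContDiff ℝ N (f μ) := fun μ _ =>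
    ((hPc μ).comp (EuclideanSpace.proj μ : EuclideanSpace ℝ (Fin 4) →L[ℝ] ℝ).contDiff).of_le (mod_cast le_top)
  have hK : (0 : ℝ) ≤ 2 ^ 20 * ((N : ℝ) + 1) ^ 2 / (a * w) := by positivity
  have hfb : ∀ μ ∈ (Finset.univ : Finset (Fin 4)), ∀ b ≤ N, ∀ u,
      ‖iteratedFDeriv ℝ b (f μ) u‖ ≤ ((2 : ℝ) ^ 20 * ((N : ℝ) + 1) ^ 2 / (a * w)) ^ b := by
    intro μ _ b hb u
    have h := ptuDeriv_geom_comp_clm (EuclideanSpace.proj μ : EuclideanSpace ℝ (Fin 4) →L[ℝ] ℝ)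
      (ptuDeriv_norm_proj_le μ) (hPc μ) (ptuDeriv_plateau_bound haw _ _ N) b hb u
    rwa [one_mul] at h
  refine ⟨fun u => ?_, fun b hb u => ?_⟩
  · rw [hfun]
    exact ptuDeriv_prod_mem _ (fun μ _ u => ptuPlateau_mem _ _ _ _) u
  · rw [hfun]
    refine (ptuDeriv_geom_prod _ hfc hK hfb b hb u).trans (le_of_eq ?_)
    rw [Finset.card_univ, Fintype.card_fin]
    push_cast
    ring

end Summit.QuantumFields.YangMills.Theorems.ContinuumLegGivenGap

end
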